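import Summits.ResolutionOfSingularities.ResolutionOfSingularities.Theorems.RisoStrataRisoCentresResolveIsolatedStep
import Summits.ResolutionOfSingularities.ResolutionOfSingularities.Theses.RisoStrata

/-!
# Crux `RisoCentresResolve` (stmt-ResolutionOfSingularities-18546) — negative lemma modulo the construction
# `IsolatedQuadraticLoop`: an immortal chain of ISOLATED singular points under the lazy quadratic transform
# along one valuation refutes the crux (the rtd-free refutation regime)

Route `ResolutionOfSingularities/RisoStrata`, crux `RisoCentresResolve` (Monreal Q1.6 in characteristic
`p`, `∃`-schedule form), lead c3 (line `Sketch`). Companion of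
`RisoCentresResolveFalseOfCollapsedTopLoop.lean` (lead c2): there the refuter must certify typed
`rtd = 0` at every singular point of every model (COLLAPSE) and a loop of the constant word; HERE no
riso datum at all is needed. The hypothesis `IsolatedQuadraticLoop` is the existence of a prime `p`,
an algebraically closed `k` of characteristic `p`, a presentation `K = k(hᵢ/hⱼ)`, a valuation ring
`O ⊇ k` and a chart `k[hᵢ/hⱼ] ⊆ O` such that every iterated quadratic transform along `O` of the local
ring at the centre of `O` is non-regular with REGULAR PUNCTURED SPECTRUM (the centre stays an isolated
singular point forever). Then every letter of every schedule is, at the centre of `O`, either inert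
(a localisation at an `O`-unit) or the blow-up of the REDUCED closed point — the centre ideal of a
letter is radical, contains `√I(Sing)`, and the centre is one of its minimal primes
(`rcr_isolated_tower`, `…IsolatedStep.lean`) — so the crux's final local ring is one of the iterated
quadratic transforms, not regular: `RisoCentresResolve` fails.

WHY THIS IS THE RIGHT SHAPE (recorded for refuters/planners; prose, not used by the kernel):
* it is the ONLY regime in which a refutation needs no value of the typed `Rtd`: at a non-isolated
  stage the germ of the centre `Z_d = closure{rtd ≤ d}` at the centre of `O` depends on two-sided rtd
  bounds along the positive-dimensional singular locus;
* it cannot be realised in characteristic `0` (at an isolated singular point the maximum locus of the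
  canonical resolution invariant is locally that point whatever the boundary — its first entry, the
  order / Hilbert–Samuel function, dominates — so the canonical algorithm run on a small neighbourhood
  blows up exactly this chain of points and terminates), hence not by toric presentations either
  (characteristic-free combinatorics), nor by surfaces whose stages are `S₂` (isolated + `S₂` = normal,
  and Lipman's normalised `Sing`-blow-ups are then the same chain);
* Hauser–Perlega (J. Algebraic Geom. 28 (2019), arXiv:1802.05010, §1) on their char-`p` cycles under
  point blow-ups: "We were not able to construct examples with cycles where the choice of point centers
  is forced (e.g., because the singularities are isolated). Of course, such an example would disprove
  the existence of resolution of singularities in positive characteristic." A witness of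
  `IsolatedQuadraticLoop` is exactly such a forced cycle (dimension ≥ 3, wild: multiplicity ≥ p at
  infinitely many stages, initial form not a `p`-th power of a linear form).

`RisoCentresResolve_false_of_IsolatedQuadraticLoop : IsolatedQuadraticLoop → ¬ RisoCentresResolve`
(`IsolatedQuadraticLoop` is the `def` of this file, to be filed as a construction item). One
`def … : Prop` (the hypothesis); kernel-only.
-/

noncomputable section

set_option linter.dupNamespace false -- mandated namespace of this single-conjunct summit

namespace Summit.ResolutionOfSingularities.ResolutionOfSingularities.Theorems

open Summit.ResolutionOfSingularities.ResolutionOfSingularities.Theses.RisoStrata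
open Literature.AlgebraicGeometry.Resolution

/-- **The construction a refuter must supply (`IsolatedQuadraticLoop`) — an IMMORTAL ISOLATED
CHAIN.** A prime `p`, an algebraically closed field `k` of characteristic `p`, a presentation
`K = k(hᵢ/hⱼ)` by `N + 1` nonzero elements, a valuation ring `O ⊇ k` of `K` and a chart
`k[hᵢ/hⱼ] ⊆ O`, such that EVERY iterated quadratic transform `R` along `O`
(`IsQuadraticTransformAlong`, Cutkosky §2.2: `R ↦ (R[𝔪_R/x])_{𝔪_O ∩ R[𝔪_R/x]}` for `x ∈ 𝔪_R` of
minimal value; zero or more steps, `Relation.ReflTransGen`) of the local ring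
`R₀ = k[hᵢ/hⱼ]_{𝔪_O ∩ k[hᵢ/hⱼ]}` (`locAtCentre`) is (i) NOT a regular local ring and (ii) has a
REGULAR PUNCTURED SPECTRUM: `R_Q` is regular for every prime `Q` of `R` missing an element of
positive value (i.e. `Q ≠ 𝔪_R`) — the centre of `O` is an isolated singular point at every stage
of the lazy quadratic sequence, forever. No riso / Hahn-series datum occurs in this statement. -/
def IsolatedQuadraticLoop : Prop :=
  ∃ (p : ℕ) (_ : p.Prime) (k : Type) (_ : Field k) (_ : CharP k p) (_ : IsAlgClosed k)
    (K : Type) (_ : Field K) (_ : Algebra k K) (N : ℕ) (h : Fin (N + 1) → K),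
    (∀ i, h i ≠ 0) ∧
    IntermediateField.adjoin k
      (Set.range fun ij : Fin (N + 1) × Fin (N + 1) => h ij.1 * (h ij.2)⁻¹) = ⊤ ∧
    ∃ O : ValuationSubring K, (∀ c : k, algebraMap k K c ∈ O) ∧
      ∃ j : Fin (N + 1), (∀ i, h i * (h j)⁻¹ ∈ O) ∧
        ∀ R : Subring K,
          Relation.ReflTransGen (IsQuadraticTransformAlong O)
            (locAtCentre (Algebra.adjoin k (Set.range fun i => h i * (h j)⁻¹)).toSubring O) R →
          ¬ IsRegularLocalRing ↥R ∧
            ∀ (Q : Ideal ↥R) [Q.IsPrime], (∃ r : ↥R, O.valuation (r : K) < 1 ∧ r ∉ Q) →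
              IsRegularLocalRing (Localization.AtPrime Q)

/-- **`IsolatedQuadraticLoop → ¬ RisoCentresResolve` (the rtd-free refutation regime).** Along the
valuation ring `O` of an immortal isolated chain, EVERY schedule of the crux fails: by the rtd-free
tower theorem `rcr_isolated_tower` each letter is lazy or acts as the quadratic transform along `O`
(the centre being an isolated singular point, the centre ideal of any letter localises to the unit
ideal or to the maximal ideal), so for admissible denominators (`rcr_exists_admissible`) the local
ring at the centre of `O` of the final stage is an iterated quadratic transform of `R₀`, NOT regular
by hypothesis (i) — contradicting the crux's regularity. No typed-`Rtd` value is used: this is the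
one refutation regime that needs no Hahn-series computation (companion of
`RisoCentresResolve_false_of_CollapsedTopLoop`, which needs typed rtd `= 0` everywhere). By the
remark of Hauser–Perlega (J. Algebraic Geom. 28 (2019), arXiv:1802.05010, §1: "We were not able to
construct examples with cycles where the choice of point centers is forced (e.g., because the
singularities are isolated). Of course, such an example would disprove the existence of resolution of
singularities in positive characteristic") the construction is open; it is impossible in
characteristic zero (canonical resolution blows up exactly this chain at isolated singular points)
and for toric presentations (characteristic-free combinatorics). [folklore] -/
theorem RisoCentresResolve_false_of_IsolatedQuadraticLoop :
    IsolatedQuadraticLoop → ¬ RisoCentresResolve := by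
  rintro ⟨p, hp, k, _, _, _, K, _, _, N, h, hh, hgen, O, hk, j, hj, hloop⟩ hR
  have hs : RisoSchedule (fun (B : Subalgebra k K) (m : Ideal ↥B) (d : ℕ) => ¬ ∃ (n : ℕ) (g : Fin n → ↥B), (∀ i, g i ∈ m) ∧ Algebra.adjoin k (Set.range fun i => (g i : K)) = B ∧ ∃ W : Submodule k (Fin n → k), d + 1 ≤ Module.finrank k ↥W ∧ ∃ φ : {α : ↥B →ₐ[k] HahnSeries ℚ k // ∀ b ∈ m, 0 < (α b).orderTop} → (Fin n → HahnSeries ℚ k), (∀ a b : {α : ↥B →ₐ[k] HahnSeries ℚ k // ∀ b ∈ m, 0 < (α b).orderTop}, a ≠ b → ∃ j, ∀ i, (a.1 (g j) - b.1 (g j)).orderTop < ((φ a i - φ b i) - (a.1 (g i) - b.1 (g i))).orderTop) ∧ (∀ a i, 0 < (φ a i).orderTop) ∧ (∀ a, ∀ w : Fin n → HahnSeries ℚ k, (∀ i, 0 < (w i).orderTop) → w ∈ Submodule.span (HahnSeries ℚ k) ((fun u : Fin n → k => fun i => HahnSeries.C (u i)) '' (W : Set (Fin n → k))) → ∃ b,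 φ b = φ a + w)) N h := hR p hp k K N h hh hgen
  obtain ⟨sched, hsched⟩ := hs
  set P : ∀ B : Subalgebra k K, Ideal ↥B → ℕ → Prop := (fun (B : Subalgebra k K) (m : Ideal ↥B) (d : ℕ) => ¬ ∃ (n : ℕ) (g : Fin n → ↥B), (∀ i, g i ∈ m) ∧ Algebra.adjoin k (Set.range fun i => (g i : K)) = B ∧ ∃ W : Submodule k (Fin n → k), d + 1 ≤ Module.finrank k ↥W ∧ ∃ φ : {α : ↥B →ₐ[k] HahnSeries ℚ k // ∀ b ∈ m, 0 < (α b).orderTop} → (Fin n → HahnSeries ℚ k), (∀ a b : {α : ↥B →ₐ[k] HahnSeries ℚ k // ∀ b ∈ m, 0 < (α b).orderTop}, a ≠ b → ∃ j, ∀ i, (a.1 (g j) - b.1 (g j)).orderTop < ((φ a i - φ b i) - (a.1 (g i) - b.1 (g i))).orderTop) ∧ (∀ a i, 0 < (φ a i).orderTop) ∧ (∀ a, ∀ w : Fin n → HahnSeries ℚ k, (∀ i, 0 < (w i).orderTop) → w ∈ Submodule.span (HahnSeries ℚ k) ((fun u : Fin n → k => fun i => HahnSeries.C (u i)) '' (W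 : Set (Fin n → k))) → ∃ b, φ b = φ a + w)) with hPdef
  set B₀ : Subalgebra k K := Algebra.adjoin k (Set.range fun i => h i * (h j)⁻¹) with hB₀def
  have hB₀ : B₀.FG := curveAssembly_chart_fg h j
  have hB₀O : B₀.toSubring ≤ O.toSubring := chart_toSubring_le hk h j hj
  -- admissible denominators for the crux's schedule along `O`
  obtain ⟨x, hx⟩ := rcr_exists_admissible P O B₀ hB₀ hB₀O sched sched.length
  have hadm : ∀ s, s < sched.length →
      risoValid P O (risoStage P B₀ sched x s) (sched.getD s 0) (x s) := fun s hs => hx s hs hs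
  -- the rtd-free tower: the final local ring is an iterated quadratic transform of `R₀`
  have htower := rcr_isolated_tower P B₀ hB₀ O hB₀O
    (fun R hRch Q _ hQ => (hloop R hRch).2 Q hQ) sched x sched.length le_rfl hadm
  have hnreg := (hloop _ htower).1
  -- the crux says it is regular
  have hreg : IsRegularLocalRing ↥(risoLoc O (risoStage P B₀ sched x sched.length)) :=
    hsched O hk j hj x hadm
  exact hnreg hreg

end Summit.ResolutionOfSingularities.ResolutionOfSingularities.Theorems

end
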